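import Summits.BirchSwinnertonDyer.BirchSwinnertonDyer.Theorems.SylvesterTwoHeegnerIndexCoupledTelescopeResidueFour
import Summits.BirchSwinnertonDyer.BirchSwinnertonDyer.Theorems.SylvesterTwoHeegnerIndexCoupledTelescopeTailFourOfResidue
import Summits.BirchSwinnertonDyer.BirchSwinnertonDyer.Theorems.SylvesterTwoHeegnerIndexCoupledTelescopeConeDischarge
import HarnessLib

/-!
# The COUPLED Cassels–Tate telescope, LV: VARIANT N's TAIL at `p ≡ 4 (mod 9)` FROM clause (vii) AND THE THREE
# DISPLAYED INPUTS (crux `UpperOffV0HSYPlus`, stmt-BirchSwinnertonDyer-19804)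

The skeleton of record VARIANT Q (`Cruxes/UpperOffV0HSYPlus/Lines/coupled_variantQ.lean` d342db51dc602551) closes
`tailFour_closed` as `tailFour_of_residue (vii) H3_holds LP_holds stub_residueFour`.  With RESIDUE 4 assembled
(`residueFour_of_printInputs`, LIV) the same composition gives VARIANT N's `stub_tailFour` statement VERBATIM behind:
clause (vii) of `casselsTate_canonical_adjoint` for every quadratic `K` (the `hvii` binder of `tailFour_of_residue`,
= `stub_printInputVII ⋯ .2`), HSY's `Dt` of degree `6`, the named display `hD`, and (ES2) `hES2`.  This file is also
the kernel's TYPE CHECK that `residueFour_of_printInputs` has exactly the stub's (= `hR`'s) type.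
* ★ `tailFour_of_printInputs`.
HONEST LABEL: CONDITIONAL closure (four displayed inputs); no stub closed on the ledger by this file; nothing asserted on
19804; X12.CMAtTwo NOT proved; BSD not claimed for any curve.  Theorems only.  Sources: [McCallumLMS1991] §1 Theorem,
§5 Thm. 5.4, Cor. 5.6; [GrossLMS1991] §3–§5; [HuShuYin2019] Thm. 1.4, §4.1.
-/

set_option linter.dupNamespace false -- Summits modules are `Summit.<Summit>.<Problem>…` by design
set_option autoImplicit false

noncomputable section

open scoped Classical AddSubgroup

open WeierstrassCurve Literature.NumberTheory.EllipticCurves Field NumberField IsDedekindDomain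
  Literature.NumberTheory.GaloisRepresentations Literature.NumberTheory.GaloisCohomology
  Literature.GroupTheory.FiniteAbelian Literature.NumberTheory.EllipticCurves.KolyvaginDescent
  Literature.NumberTheory.EllipticCurves.HuShuYin2019
  Literature.NumberTheory.EllipticCurves.ModularForms
open Literature.NumberTheory.GaloisRepresentations.DiscreteGaloisModule (mu)
open Summit.BirchSwinnertonDyer.BirchSwinnertonDyer.Theses.SylvesterTwoHeegnerIndex
  hiding HSYPointTwoDivisibleSevenModNine

namespace Summit.BirchSwinnertonDyer.BirchSwinnertonDyer.Theorems.SylvesterTwoCoupledTelescope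

set_option maxHeartbeats 1600000 in
/-- ★ **VARIANT N's `stub_tailFour` (the `2`-part of the product of the Tate–Shafarevich groups of the Sylvester pair
at `p ≡ 4 (mod 9)` is bounded by the analytic side) MODULO clause (vii), `Dt` of degree `6`, the named display and
(ES2)**: `tailFour_of_residue (vii) H3_holds LP_holds (residueFour_of_printInputs Dt hdeg hD hES2)`.  CONDITIONAL
closure; the ledger stubs stay open; BSD is not proved by any of this.
[cite: McCallumLMS1991, §1 Theorem; §5 Thm. 5.4, Cor. 5.6] [cite: GrossLMS1991, §3–§5] [cite: HuShuYin2019, Thm. 1.4, §4.1] -/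
theorem tailFour_of_printInputs
    (hvii : ∀ (K : Type) [Field K] [NumberField K] (σ₀ : K ≃ₐ[ℚ] K) (h2 : Module.finrank ℚ K = 2)
      (hσ₀ : σ₀ ≠ 1),
      ∀ (W : WeierstrassCurve ℚ) [W.IsElliptic] (m : ℕ) [NeZero m]
      (eℚ : geomTorsion W ((m * m : ℕ) : ℤ) → geomTorsion W ((m * m : ℕ) : ℤ) → AlgebraicClosure ℚ)
      (hμ : ∀ S T, eℚ S T ^ (m * m) = 1)
      (hadd₁ : ∀ S₁ S₂ T, eℚ (S₁ + S₂) T = eℚ S₁ T * eℚ S₂ T)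
      (hadd₂ : ∀ S T₁ T₂, eℚ S (T₁ + T₂) = eℚ S T₁ * eℚ S T₂)
      (hgal : ∀ (σ : absoluteGaloisGroup ℚ) (S T : geomTorsion W ((m * m : ℕ) : ℤ)),
        σ • eℚ S T = eℚ (σ • S) (σ • T))
      (eK : geomTorsion (W.baseChange K) ((m * m : ℕ) : ℤ) →
        geomTorsion (W.baseChange K) ((m * m : ℕ) : ℤ) → AlgebraicClosure K)
      (hμK : ∀ S T, eK S T ^ (m * m) = 1)
      (hadd₁K : ∀ S₁ S₂ T, eK (S₁ + S₂) T = eK S₁ T * eK S₂ T)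
      (hadd₂K : ∀ S T₁ T₂, eK S (T₁ + T₂) = eK S T₁ * eK S T₂)
      (hgalK : ∀ (σ : absoluteGaloisGroup K) (S T : geomTorsion (W.baseChange K) ((m * m : ℕ) : ℤ)),
        σ • eK S T = eK (σ • S) (σ • T)),
      (∀ T, eℚ T T = 1) → (∀ T, (∀ S, eℚ S T = 1) → T = 0) →
      (∀ T, eK T T = 1) → (∀ T, (∀ S, eK S T = 1) → T = 0) →
      (∀ (S T : geomTorsion W ((m * m : ℕ) : ℤ)) (S' T' : geomTorsion (W.baseChange K) ((m * m : ℕ) : ℤ)),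
        (S' : geomPoints (W.baseChange K)) = geomPointsEquivBaseChange K W S →
        (T' : geomPoints (W.baseChange K)) = geomPointsEquivBaseChange K W T →
        (eK S' T' : AlgebraicClosure K) = closureEmb (K := ℚ) K (eℚ S T)) →
      ∀ (a : W.galH1) (c : (W.baseChange K).galH1), a ∈ W.sha → c ∈ (W.baseChange K).sha →
        (m : ℤ) • a = 0 → (m : ℤ) • c = 0 → corBaseChange K W σ₀ h2 hσ₀ c ∈ W.sha →
        ctGeneralFun (W.baseChange K) m eK hμK hadd₁K hadd₂K hgalK (LocalInvariants.canonical K (m * m))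
            (resBaseChange W K a) c =
          ctGeneralFun W m eℚ hμ hadd₁ hadd₂ hgal (LocalInvariants.canonical ℚ (m * m))
            a (corBaseChange K W σ₀ h2 hσ₀ c))
    -- H3 = `Ш³(F, μ_n) = 0` (cone-interim, displayed; the cone's `VisiblePairAtTwo.shaThree_mu_eq_zero`)
    (Dt : ModularParametrizationData (⟨0, 0, 1, 0, -1⟩ : WeierstrassCurve ℚ) 243) (hdeg : Dt.deg = 6)
    (hD : shaAnPair_mul_height_eq_two_zpow_mul_height_named)
    (hES2 : Nekovar2007.cmPoint_frobeniusCongruence) :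
    PublishedFactsTwoPlus →
    ∀ (p : ℕ), p.Prime → p % 9 = 4 → (¬ ∃ x : ZMod p, x ^ 3 = 3) →
      ∀ (A B : WeierstrassCurve ℚ) [A.IsElliptic] [A.IsGloballyMinimal] [B.IsElliptic]
        [B.IsGloballyMinimal], (∃ C : VariableChange ℚ, C • B = HuShuYin2019.cubeSumCurve (p : ℚ)) →
        (∃ C : VariableChange ℚ, C • A = HuShuYin2019.cubeSumCurve (3 * (p : ℚ) ^ 2)) →
        4 < Nat.card (AddCommGroup.primaryComponent B.sha 2) *
            Nat.card (AddCommGroup.primaryComponent A.sha 2) →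
        ∃ qB qA : ℚ, shaAn B = (qB : ℂ) ∧ shaAn A = (qA : ℂ) ∧ qB * qA ≠ 0 ∧
          (padicValNat 2 (Nat.card (AddCommGroup.primaryComponent B.sha 2)) : ℤ) +
              (padicValNat 2 (Nat.card (AddCommGroup.primaryComponent A.sha 2)) : ℤ) ≤
            padicValRat 2 (qB * qA) :=
  tailFour_of_residue hvii H3_holds LP_holds (residueFour_of_printInputs Dt hdeg hD hES2)

end Summit.BirchSwinnertonDyer.BirchSwinnertonDyer.Theorems.SylvesterTwoCoupledTelescope

end
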